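import Summits.PneNP.PneNP.Theorems.ChebyshevTracialDesignPsdCells
import Summits.PneNP.PneNP.Theorems.ChebyshevTracialDesignSynchronisationTools
import Summits.PneNP.PneNP.Theorems.ChebyshevTracialDesignDimTwoAlgebra
import HarnessLib

/-!
# Cell pnp-psdrank, route `ChebyshevTracialDesign`: SYNCHRONISATION IN DIMENSION TWO — the dense non-crossing psd cell at `r = 2` for singular
# pairs, by label synchronisation instead of a net

First kernel instance of the incidence-rigidity line of MEMO-14 §5 for the crux `TracialDecayExp20` (stmt-PneNP-19878), brick 61 (prover g11).
`singular_pair_value_le`: for a level weight `W = levelWeight n t C w` (`Σ|w_c| ≤ B_v`) whose ONE-dimensional tracial value is `≤ γ`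
(`TracialValueLEAt W γ 1`, the `r = 1` rung), and a tight-orthogonal psd rectangle `(X, Y)` of dimension `2` on the `t`-cuts with all operators
SINGULAR (brick 58 / brick 60 make this WLOG at cost `O(γ)`), the quantitative non-tightness hypothesis `hSNT` — every `[0,1]` cut weight of mass
`≥ ε·#t-cuts` and every sub-weight of `tr(Y_·)/2` carrying at least half of its mass have an ACTIVE TIGHT PAIR (the cell's (SNT-q), mod
Keevash–Lifshitz, applied to the homogeneous-dense matching side; brick 59 keeps homogeneity under such restrictions) — and cut mass `≥ 2ε·#t-cuts` give
      `Σ_U Σ_M W(U,M)·tr(X_U Y_M) ≤ 2γ + 4·B_v·ε`.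
Proof = MEMO-14 §5 (a): singular operators are `tr·(rank-one label)` (brick 60 `label_proj`); an active tight pair has `P_U Q_M = 0`, i.e. EQUAL labels
`P_U = 1 − Q_M` (`eq_one_sub_of_mul_eq_zero`); `hSNT` turns this into the premise of the MAJORITY LEMMA (brick 59 `exists_heavy_label`): every
`ε`-heavy label set carries more than half of the matching mass; so ONE label `P*` carries all but `2ε·#t-cuts` of the cut mass; off that class the
trace marginal (brick 51 `abs_cell_value_le_row`) gives `≤ 4B_v ε`; on it the cut side is the one-element dictionary `{P*}` and
`(tr(X_U)/2, tr(P* Y_M))` is a tight ONE-dimensional rectangle, `≤ γ` by the `r = 1` rung. No `(2L+1)^{2r}` net (contrast `…BoundedDimension`).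
[cite: Rothvoss2017, §2 (PDF p. 6)] [cite: BrietDadushPokutta2014, Thm. 6 (§3)] [cite: KupavskiiZakharov2022, §2]
Stature: support/instrument (no defs; the (SNT-q) input and the `r = 1` rung are hypotheses). WHAT THIS IS NOT: not the dense cell for `r > 2`,
nothing on psd rank, no P-vs-NP content. Supports stmt-PneNP-19878.
-/

set_option linter.dupNamespace false -- `Summit.PneNP.PneNP.…`: summit = sub-problem (D-0017)

noncomputable section

namespace Summit.PneNP.PneNP.Theorems.ChebyshevTracialDesignDimTwoSynchronisation

open Finset Matrix Literature.Barriers.PneNP Literature.Combinatorics.Optimization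
open Summit.PneNP.PneNP.Theorems.ChebyshevTracialDesignAPrioriBounds (trace_mul_le_trace_left)
open Summit.PneNP.PneNP.Theorems.ChebyshevTracialDesignPsdCells (abs_cell_value_le_row)
open Summit.PneNP.PneNP.Theorems.ChebyshevTracialDesignSynchronisationTools (exists_heavy_label)
open Summit.PneNP.PneNP.Theorems.ChebyshevTracialDesignDimTwoAlgebra
open Literature.NumberTheory.Automorphic (mul_self_eq_trace_smul_sub_det_smul)

variable {n : ℕ}

/-! ### §3 Synchronisation of singular tight pairs in dimension two -/

set_option maxHeartbeats 800000 in -- measured: fails at 300000, passes at 400000; 2× head-room against heartbeat cliffs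
/-- **SYNCHRONISATION AT `r = 2` (singular pairs).** Let `W = levelWeight n t C w` with `Σ|w_c| ≤ B_v`, `γ ≥ 0` a bound for the tracial value of `W`
in dimension ONE (`TracialValueLEAt W γ 1`: every tight `[0,1]`-weighted rectangle — the `r = 1` rung), and `(X, Y)` a tight-orthogonal psd rectangle of
dimension `2` supported on the `t`-cuts with EVERY `X_U` AND EVERY `Y_M` SINGULAR (`det = 0`; brick 58's peeling / `exists_lowerBound_singular`). Assume
the quantitative non-tightness in the form actually used (hypothesis `hSNT`, the cell's (SNT-q) for the given matching side): every `[0,1]`-weight `x`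
on the `t`-cuts of mass `≥ ε·#t-cuts` and every sub-weight `y' ≤ tr(Y_·)/2` carrying at least HALF of `Σ_M tr(Y_M)/2` have an ACTIVE TIGHT PAIR.
If the cut side has mass `Σ_U tr(X_U)/2 ≥ 2ε·#t-cuts`, then `Σ_U Σ_M W(U,M)·tr(X_U Y_M) ≤ 2γ + 4·B_v·ε`.
Mechanism (MEMO-14 §5 (a)): singular `2 × 2` operators are `tr(X_U)·P_U`, `tr(Y_M)·Q_M` with rank-one projections; tightness of an active pair is
`P_U Q_M = 0`, i.e. `P_U = 1 − Q_M` (ANGLE SYNCHRONISATION); by `hSNT` every `ε`-heavy set of labels carries more than half of the matching mass, so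
the majority lemma (brick 59) leaves ONE label `P*` carrying all but `2ε` of the cut mass; on that class the cut side is the dictionary `{P*}` and the
kernel `tr(X_U)·tr(P* Y_M)` is a tight one-dimensional rectangle (`≤ 2γ`), the other classes are junk by the trace marginal (`≤ 4B_v ε`).
[cite: Rothvoss2017, §2 (PDF p. 6)] [cite: BrietDadushPokutta2014, Thm. 6 (§3)] [cite: KupavskiiZakharov2022, §2] -/
theorem singular_pair_value_le {t : ℕ} (C : Finset ℕ) (w : ℕ → ℝ) {Bv γ ε : ℝ} (hBv : ∑ c ∈ C, |w c| ≤ Bv) (hε : 0 < ε)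
    (hγ : TracialValueLEAt (levelWeight n t C w) γ 1)
    {X : OddSet n → Matrix (Fin 2) (Fin 2) ℝ} {Y : PMatch n → Matrix (Fin 2) (Fin 2) ℝ} (hXY : IsPsdRect X Y)
    (hXt : ∀ U, U.1.card ≠ t → X U = 0) (hXdet : ∀ U, (X U).det = 0) (hYdet : ∀ M, (Y M).det = 0)
    (hSNT : ∀ (x : OddSet n → ℝ) (y' : PMatch n → ℝ), (∀ U, 0 ≤ x U ∧ x U ≤ 1) → (∀ U, U.1.card ≠ t → x U = 0) →
      ε * ((univ.filter fun U : OddSet n => U.1.card = t).card : ℝ) ≤ ∑ U, x U →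
      (∀ M, 0 ≤ y' M ∧ y' M ≤ (Y M).trace / 2) → (∑ M, (Y M).trace / 2) ≤ 2 * ∑ M, y' M →
      ∃ U M, cc U M = 1 ∧ 0 < x U ∧ 0 < y' M)
    (hdens : 2 * (ε * ((univ.filter fun U : OddSet n => U.1.card = t).card : ℝ)) ≤ ∑ U, (X U).trace / 2) :
    ∑ U, ∑ M, levelWeight n t C w U M * (X U * Y M).trace ≤ 2 * γ + 4 * Bv * ε := by
  classical
  set Nt : ℝ := ((univ.filter fun U : OddSet n => U.1.card = t).card : ℝ) with hNt
  have hBv0 : 0 ≤ Bv := (sum_nonneg fun c _ => abs_nonneg (w c)).trans hBv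
  -- active index sets and labels
  set Ap := (univ : Finset (OddSet n)).filter (fun U => X U ≠ 0) with hAp
  set Bp := (univ : Finset (PMatch n)).filter (fun M => Y M ≠ 0) with hBp
  set Pf : OddSet n → Matrix (Fin 2) (Fin 2) ℝ := fun U => ((X U).trace)⁻¹ • X U with hPf
  set Lf : PMatch n → Matrix (Fin 2) (Fin 2) ℝ := fun M => 1 - ((Y M).trace)⁻¹ • Y M with hLf
  have htrX : ∀ U ∈ Ap, 0 < (X U).trace := fun U hU => trace_pos_of_ne_zero (hXY.1 U).1 (mem_filter.1 hU).2
  have htrY : ∀ M ∈ Bp, 0 < (Y M).trace := fun M hM => trace_pos_of_ne_zero (hXY.2.1 M).1 (mem_filter.1 hM).2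
  have hP : ∀ U ∈ Ap, Pf U * Pf U = Pf U ∧ (Pf U)ᵀ = Pf U ∧ (Pf U).trace = 1 ∧ X U = (X U).trace • Pf U :=
    fun U hU => label_proj (hXY.1 U).1 (hXdet U) (htrX U hU)
  have hQ : ∀ M ∈ Bp, (((Y M).trace)⁻¹ • Y M) * (((Y M).trace)⁻¹ • Y M) = ((Y M).trace)⁻¹ • Y M ∧
      (((Y M).trace)⁻¹ • Y M)ᵀ = ((Y M).trace)⁻¹ • Y M ∧ (((Y M).trace)⁻¹ • Y M).trace = 1 ∧
      Y M = (Y M).trace • (((Y M).trace)⁻¹ • Y M) :=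
    fun M hM => label_proj (hXY.2.1 M).1 (hYdet M) (htrY M hM)
  -- SYNCHRONISATION: an active tight pair has equal labels
  have hsync : ∀ U ∈ Ap, ∀ M ∈ Bp, cc U M = 1 → Pf U = Lf M := by
    intro U hU M hM hcc
    obtain ⟨hPi, hPs, hPt, hXeq⟩ := hP U hU
    obtain ⟨hQi, hQs, hQt, hYeq⟩ := hQ M hM
    have hPQ : Pf U * (((Y M).trace)⁻¹ • Y M) = 0 := by
      have h := hXY.2.2 U M hcc
      rw [hXeq, hYeq, smul_mul_smul_comm, smul_eq_zero] at h
      exact h.resolve_left (mul_ne_zero (htrX U hU).ne' (htrY M hM).ne')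
    have := eq_one_sub_of_mul_eq_zero hPs hPi hPt hQs hQi hQt hPQ
    -- `Q = 1 − P` ⇒ `L = 1 − Q = P`
    show Pf U = 1 - ((Y M).trace)⁻¹ • Y M
    rw [this, sub_sub_cancel]
  -- the label set and the two masses
  set Λ : Finset (Matrix (Fin 2) (Fin 2) ℝ) := Ap.image Pf ∪ Bp.image Lf with hΛ
  set a : Matrix (Fin 2) (Fin 2) ℝ → ℝ := fun i => ∑ U ∈ Ap.filter (fun U => Pf U = i), (X U).trace / 2 with ha
  set b : Matrix (Fin 2) (Fin 2) ℝ → ℝ := fun i => ∑ M ∈ Bp.filter (fun M => Lf M = i), (Y M).trace / 2 with hb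
  have hPmem : ∀ U ∈ Ap, Pf U ∈ Λ := fun U hU => mem_union_left _ (mem_image_of_mem _ hU)
  have hLmem : ∀ M ∈ Bp, Lf M ∈ Λ := fun M hM => mem_union_right _ (mem_image_of_mem _ hM)
  -- class sums
  have haG : ∀ G : Finset (Matrix (Fin 2) (Fin 2) ℝ), ∑ i ∈ G, a i = ∑ U ∈ Ap.filter (fun U => Pf U ∈ G), (X U).trace / 2 := by
    intro G
    rw [ha]
    exact (sum_fiberwise_of_maps_to (s := Ap.filter (fun U => Pf U ∈ G)) (t := G) (g := Pf)
      (f := fun U => (X U).trace / 2) (fun U hU => (mem_filter.1 hU).2)).symm.trans (by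
        refine sum_congr rfl fun i hi => sum_congr ?_ fun _ _ => rfl
        ext U; simp only [mem_filter]; constructor
        · rintro ⟨⟨hU, -⟩, h⟩; exact ⟨hU, h⟩
        · rintro ⟨hU, h⟩; exact ⟨⟨hU, h ▸ hi⟩, h⟩) |>.symm
  have hbG : ∀ G : Finset (Matrix (Fin 2) (Fin 2) ℝ), ∑ i ∈ G, b i = ∑ M ∈ Bp.filter (fun M => Lf M ∈ G), (Y M).trace / 2 := by
    intro G
    rw [hb]
    exact (sum_fiberwise_of_maps_to (s := Bp.filter (fun M => Lf M ∈ G)) (t := G) (g := Lf)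
      (f := fun M => (Y M).trace / 2) (fun M hM => (mem_filter.1 hM).2)).symm.trans (by
        refine sum_congr rfl fun i hi => sum_congr ?_ fun _ _ => rfl
        ext M; simp only [mem_filter]; constructor
        · rintro ⟨⟨hM, -⟩, h⟩; exact ⟨hM, h⟩
        · rintro ⟨hM, h⟩; exact ⟨⟨hM, h ▸ hi⟩, h⟩) |>.symm
  -- total masses
  have haΛ : ∑ i ∈ Λ, a i = ∑ U, (X U).trace / 2 := by
    rw [haG Λ, filter_true_of_mem hPmem, hAp, sum_filter]
    refine sum_congr rfl fun U _ => ?_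
    split_ifs with h
    · rfl
    · push Not at h; rw [h, trace_zero, zero_div]
  have hbΛ : ∑ i ∈ Λ, b i = ∑ M, (Y M).trace / 2 := by
    rw [hbG Λ, filter_true_of_mem hLmem, hBp, sum_filter]
    refine sum_congr rfl fun M _ => ?_
    split_ifs with h
    · rfl
    · push Not at h; rw [h, trace_zero, zero_div]
  -- MAJORITY PREMISE from `hSNT` + synchronisation
  have hmaj : ∀ G, G ⊆ Λ → ε * Nt ≤ ∑ i ∈ G, a i → ∑ i ∈ Λ, b i < 2 * ∑ i ∈ G, b i := by
    intro G hG hGa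
    by_contra hle
    push Not at hle
    -- cut weight on the `G`-classes, matching weight on the complementary classes
    set x : OddSet n → ℝ := fun U => if U ∈ Ap.filter (fun U => Pf U ∈ G) then (X U).trace / 2 else 0 with hx
    set y' : PMatch n → ℝ := fun M => if M ∈ Bp.filter (fun M => Lf M ∉ G) then (Y M).trace / 2 else 0 with hy'
    have hx01 : ∀ U, 0 ≤ x U ∧ x U ≤ 1 := by
      intro U; rw [hx]; dsimp only; split_ifs
      · exact ⟨div_nonneg (hXY.1 U).1.trace_nonneg two_pos.le, by have := trace_le_two (hXY.1 U).2; linarith⟩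
      · exact ⟨le_rfl, zero_le_one⟩
    have hxt : ∀ U, U.1.card ≠ t → x U = 0 := by
      intro U hU; rw [hx]; dsimp only; rw [if_neg]
      intro h; exact (mem_filter.1 (mem_filter.1 h).1).2 (hXt U hU)
    have hxsum : ∑ U, x U = ∑ i ∈ G, a i := by
      rw [haG G, hx, ← sum_filter]; congr 1; ext U; simp
    have hy'01 : ∀ M, 0 ≤ y' M ∧ y' M ≤ (Y M).trace / 2 := by
      intro M; rw [hy']; dsimp only; split_ifs
      · exact ⟨div_nonneg (hXY.2.1 M).1.trace_nonneg two_pos.le, le_rfl⟩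
      · exact ⟨le_rfl, div_nonneg (hXY.2.1 M).1.trace_nonneg two_pos.le⟩
    have hy'sum : ∑ M, y' M = ∑ i ∈ Λ, b i - ∑ i ∈ G, b i := by
      have h1 : ∑ M, y' M = ∑ M ∈ Bp.filter (fun M => Lf M ∉ G), (Y M).trace / 2 := by
        rw [hy', ← sum_filter]; congr 1; ext M; simp
      have h2 : ∑ M ∈ Bp, (Y M).trace / 2 = ∑ M ∈ Bp.filter (fun M => Lf M ∈ G), (Y M).trace / 2 +
          ∑ M ∈ Bp.filter (fun M => Lf M ∉ G), (Y M).trace / 2 := (sum_filter_add_sum_filter_not Bp _ _).symm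
      have h3 : ∑ M ∈ Bp, (Y M).trace / 2 = ∑ i ∈ Λ, b i := by rw [hbG Λ, filter_true_of_mem hLmem]
      rw [h1]; rw [hbG G]; linarith [h2, h3]
    have hhalf : (∑ M, (Y M).trace / 2) ≤ 2 * ∑ M, y' M := by rw [hy'sum, ← hbΛ]; linarith
    obtain ⟨U, M, hcc, hxU, hyM⟩ := hSNT x y' hx01 hxt (by rw [hxsum]; exact hGa) hy'01 hhalf
    have hU : U ∈ Ap.filter (fun U => Pf U ∈ G) := by
      by_contra h; rw [hx] at hxU; dsimp only at hxU; rw [if_neg h] at hxU; exact lt_irrefl _ hxU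
    have hM : M ∈ Bp.filter (fun M => Lf M ∉ G) := by
      by_contra h; rw [hy'] at hyM; dsimp only at hyM; rw [if_neg h] at hyM; exact lt_irrefl _ hyM
    obtain ⟨hUA, hUG⟩ := mem_filter.1 hU
    obtain ⟨hMB, hMG⟩ := mem_filter.1 hM
    exact hMG (hsync U hUA M hMB hcc ▸ hUG)
  -- the heavy label
  rcases le_or_gt (ε * Nt) 0 with hN0 | hNpos
  · -- no `t`-cuts (or none needed): everything is junk
    have hNt0 : Nt = 0 := le_antisymm (by nlinarith) (by rw [hNt]; positivity)
    have hall : ∀ U : OddSet n, X U = 0 := by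
      intro U
      by_cases hU : U.1.card = t
      · exfalso
        have : (0 : ℝ) < Nt := by
          rw [hNt]; exact_mod_cast card_pos.2 ⟨U, mem_filter.2 ⟨mem_univ _, hU⟩⟩
        linarith
      · exact hXt U hU
    have : ∑ U, ∑ M, levelWeight n t C w U M * (X U * Y M).trace = 0 :=
      sum_eq_zero fun U _ => sum_eq_zero fun M _ => by rw [hall U, Matrix.zero_mul, trace_zero, mul_zero]
    rw [this]
    have hγ0 : 0 ≤ γ := by
      have h := hγ (fun _ => 0) (fun _ => 0) ⟨fun _ => ⟨PosSemidef.zero, by rw [sub_zero]; exact PosSemidef.one⟩,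
        fun _ => ⟨PosSemidef.zero, by rw [sub_zero]; exact PosSemidef.one⟩, fun _ _ _ => Matrix.zero_mul _⟩
      simpa using h
    positivity
  obtain ⟨istar, histar, hheavy⟩ := exists_heavy_label Λ a b hNpos hmaj (by rw [haΛ]; exact hdens)
  -- split the cut side: the class of `istar` and the rest
  set S := Ap.filter (fun U => Pf U = istar) with hS
  have hsplit : ∑ U, ∑ M, levelWeight n t C w U M * (X U * Y M).trace =
      ∑ U ∈ S, ∑ M, levelWeight n t C w U M * (X U * Y M).trace +
        ∑ U ∈ univ.filter (fun U => U ∉ S), ∑ M, levelWeight n t C w U M * (X U * Y M).trace := by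
    rw [← sum_filter_add_sum_filter_not univ (fun U => U ∈ S)]
    congr 1
    rw [filter_mem_eq_inter, univ_inter]
  rw [hsplit]
  -- the rest is junk: its cut mass is `< 2ε·Nt`... times `2`
  have hrest : ∑ U ∈ univ.filter (fun U => U ∉ S), ∑ M, levelWeight n t C w U M * (X U * Y M).trace ≤ 4 * Bv * ε := by
    have h1 := abs_cell_value_le_row (t := t) (by norm_num : 0 < 2) C w hXY (univ.filter fun U => U ∉ S) univ
    have hmass : ∑ U ∈ (univ.filter fun U : OddSet n => U ∉ S).filter (fun U => U.1.card = t), (X U).trace ≤ 2 * (2 * (ε * Nt)) := by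
      -- = Σ_{U ∈ Ap, P_U ≠ istar} tr X_U = 2·(a(Λ) − a(istar)) < 4εNt
      have h2 : ∑ U ∈ (univ.filter fun U : OddSet n => U ∉ S).filter (fun U => U.1.card = t), (X U).trace =
          ∑ U ∈ Ap.filter (fun U => Pf U ≠ istar), (X U).trace := by
        symm
        apply sum_subset_zero_on_sdiff
        · intro U hU
          obtain ⟨hUA, hne⟩ := mem_filter.1 hU
          have hX0 : X U ≠ 0 := (mem_filter.1 hUA).2
          refine mem_filter.2 ⟨mem_filter.2 ⟨mem_univ _, fun hUS => hne (mem_filter.1 hUS).2⟩, ?_⟩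
          by_contra hct
          exact hX0 (hXt U hct)
        · intro U hU
          rw [mem_sdiff] at hU
          obtain ⟨hU2, hU1⟩ := hU
          have hUS : U ∉ S := (mem_filter.1 (mem_filter.1 hU2).1).2
          by_cases hX0 : X U = 0
          · rw [hX0, trace_zero]
          · exfalso
            apply hU1
            refine mem_filter.2 ⟨mem_filter.2 ⟨mem_univ _, hX0⟩, fun heq => hUS ?_⟩
            exact mem_filter.2 ⟨mem_filter.2 ⟨mem_univ _, hX0⟩, heq⟩
        · intro _ _; rfl
      have hApsum : ∑ U ∈ Ap, (X U).trace / 2 = ∑ U, (X U).trace / 2 := by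
        rw [hAp, sum_filter]
        refine sum_congr rfl fun U _ => ?_
        split_ifs with h
        · rfl
        · push Not at h; rw [h, trace_zero, zero_div]
      have haistar : a istar = ∑ U ∈ Ap.filter (fun U => Pf U = istar), (X U).trace / 2 := rfl
      have h4 := sum_filter_add_sum_filter_not Ap (fun U => Pf U = istar) (fun U => (X U).trace / 2)
      have h3 : ∑ U ∈ Ap.filter (fun U => Pf U ≠ istar), (X U).trace / 2 = ∑ i ∈ Λ, a i - a istar := by
        rw [haΛ, ← hApsum, ← h4, haistar]; ring
      have h6 : ∑ U ∈ Ap.filter (fun U => Pf U ≠ istar), (X U).trace = 2 * (∑ i ∈ Λ, a i - a istar) := by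
        rw [← h3, mul_sum]; exact sum_congr rfl fun U _ => by ring
      rw [h2, h6]
      linarith
    have hNt' : ((univ.filter fun U : OddSet n => U.1.card = t).card : ℝ) = Nt := rfl
    rw [hNt'] at h1
    have hNpos' : 0 < Nt := by
      rcases (show (0:ℝ) ≤ Nt by rw [hNt]; positivity).eq_or_lt with h | h
      · rw [← h, mul_zero] at hNpos; exact absurd hNpos (lt_irrefl _)
      · exact h
    calc _ ≤ |∑ U ∈ univ.filter (fun U => U ∉ S), ∑ M ∈ univ, levelWeight n t C w U M * (X U * Y M).trace| := by
          simp only [sum_filter]; exact le_abs_self _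
      _ ≤ (∑ c ∈ C, |w c|) * ((∑ U ∈ (univ.filter fun U : OddSet n => U ∉ S).filter (fun U => U.1.card = t), (X U).trace) / Nt) := h1
      _ ≤ Bv * (2 * (2 * (ε * Nt)) / Nt) :=
          mul_le_mul hBv (div_le_div_of_nonneg_right hmass hNpos'.le) (div_nonneg (sum_nonneg fun U _ => (hXY.1 U).1.trace_nonneg) hNpos'.le) hBv0
      _ = 4 * Bv * ε := by field_simp; ring
  -- the heavy class is a dictionary of size one: a tight `1 × 1` rectangle
  have hmain : ∑ U ∈ S, ∑ M, levelWeight n t C w U M * (X U * Y M).trace ≤ 2 * γ := by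
    rcases S.eq_empty_or_nonempty with hS0 | ⟨U₀, hU₀⟩
    · rw [hS0, sum_empty]
      have hγ0 : 0 ≤ γ := by
        have h := hγ (fun _ => 0) (fun _ => 0) ⟨fun _ => ⟨PosSemidef.zero, by rw [sub_zero]; exact PosSemidef.one⟩,
          fun _ => ⟨PosSemidef.zero, by rw [sub_zero]; exact PosSemidef.one⟩, fun _ _ _ => Matrix.zero_mul _⟩
        simpa using h
      linarith
    -- `istar = P_{U₀}` is a rank-one projection, psd
    obtain ⟨hU₀A, hU₀i⟩ := mem_filter.1 hU₀
    obtain ⟨hIi, hIs, hIt, -⟩ := hP U₀ hU₀A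
    rw [hU₀i] at hIi hIs hIt
    have hIpsd : istar.PosSemidef := by
      rw [← hU₀i]; exact (hXY.1 U₀).1.smul (inv_nonneg.2 (hXY.1 U₀).1.trace_nonneg)
    -- the `1 × 1` pair
    set X₁ : OddSet n → Matrix (Fin 1) (Fin 1) ℝ := fun U => (if U ∈ S then (X U).trace / 2 else 0) • (1 : Matrix (Fin 1) (Fin 1) ℝ) with hX₁
    set Y₁ : PMatch n → Matrix (Fin 1) (Fin 1) ℝ := fun M => (istar * Y M).trace • (1 : Matrix (Fin 1) (Fin 1) ℝ) with hY₁
    have hY₁0 : ∀ M, 0 ≤ (istar * Y M).trace := fun M =>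
      (show Literature.Combinatorics.Optimization.HasPsdFactorization (fun (_ : Unit) (_ : Unit) => (istar * Y M).trace) 2 from
        ⟨fun _ => istar, fun _ => Y M, fun _ => hIpsd, fun _ => (hXY.2.1 M).1, fun _ _ => rfl⟩).nonneg () ()
    have hY₁1 : ∀ M, (istar * Y M).trace ≤ 1 := fun M =>
      (trace_mul_le_trace_left hIpsd (hXY.2.1 M).2).trans_eq hIt
    have h1 : IsPsdRect X₁ Y₁ := by
      refine ⟨fun U => ?_, fun M => ?_, fun U M hcc => ?_⟩
      · have hc0 : 0 ≤ (if U ∈ S then (X U).trace / 2 else 0) := by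
          split_ifs
          · exact div_nonneg (hXY.1 U).1.trace_nonneg two_pos.le
          · exact le_rfl
        have hc1 : (if U ∈ S then (X U).trace / 2 else 0) ≤ 1 := by
          split_ifs
          · have := trace_le_two (hXY.1 U).2; linarith
          · exact zero_le_one
        refine ⟨PosSemidef.one.smul hc0, ?_⟩
        have : (1 : Matrix (Fin 1) (Fin 1) ℝ) - (if U ∈ S then (X U).trace / 2 else 0) • 1 =
            (1 - (if U ∈ S then (X U).trace / 2 else 0)) • (1 : Matrix (Fin 1) (Fin 1) ℝ) := by rw [sub_smul, one_smul]
        rw [this]; exact PosSemidef.one.smul (by linarith)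
      · refine ⟨PosSemidef.one.smul (hY₁0 M), ?_⟩
        have : (1 : Matrix (Fin 1) (Fin 1) ℝ) - (istar * Y M).trace • 1 = (1 - (istar * Y M).trace) • (1 : Matrix (Fin 1) (Fin 1) ℝ) := by
          rw [sub_smul, one_smul]
        rw [this]; exact PosSemidef.one.smul (by linarith [hY₁1 M])
      · show ((if U ∈ S then (X U).trace / 2 else 0) • (1 : Matrix (Fin 1) (Fin 1) ℝ)) * ((istar * Y M).trace • 1) = 0
        rw [smul_mul_smul_comm, Matrix.one_mul]
        by_cases hUS : U ∈ S
        · rw [if_pos hUS]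
          by_cases hYM : Y M = 0
          · rw [hYM, Matrix.mul_zero, trace_zero, mul_zero, zero_smul]
          · -- active tight pair: `P_U = istar = L_M = 1 − Q_M`, so `istar · Y_M = tr(Y_M) · (1 − Q_M) Q_M = 0`
            obtain ⟨hUA, hUi⟩ := mem_filter.1 hUS
            have hMB : M ∈ Bp := mem_filter.2 ⟨mem_univ _, hYM⟩
            have hlab := hsync U hUA M hMB hcc
            rw [hUi] at hlab
            have : istar * Y M = 0 := by
              rw [hlab]
              show (1 - ((Y M).trace)⁻¹ • Y M) * Y M = 0
              rw [sub_mul, Matrix.one_mul, smul_mul_assoc, mul_self_eq_trace_smul_sub_det_smul, hYdet M, zero_smul, sub_zero, smul_smul,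
                inv_mul_cancel₀ (htrY M hMB).ne', one_smul, sub_self]
            rw [this, trace_zero, mul_zero, zero_smul]
        · rw [if_neg hUS, zero_mul, zero_smul]
    have h2 := hγ X₁ Y₁ h1
    rw [Nat.cast_one, div_one] at h2
    have h3 : ∑ U, ∑ M, levelWeight n t C w U M * (X₁ U * Y₁ M).trace =
        (∑ U ∈ S, ∑ M, levelWeight n t C w U M * (X U * Y M).trace) / 2 := by
      rw [sum_div, ← sum_filter_add_sum_filter_not univ (fun U => U ∈ S), filter_mem_eq_inter, univ_inter]
      have hz : ∑ U ∈ univ.filter (fun U => U ∉ S), ∑ M, levelWeight n t C w U M * (X₁ U * Y₁ M).trace = 0 :=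
        sum_eq_zero fun U hU => sum_eq_zero fun M _ => by
          rw [hX₁]; dsimp only; rw [if_neg (mem_filter.1 hU).2, zero_smul, Matrix.zero_mul, trace_zero, mul_zero]
      rw [hz, add_zero]
      refine sum_congr rfl fun U hU => ?_
      rw [sum_div]
      refine sum_congr rfl fun M _ => ?_
      obtain ⟨hUA, hUi⟩ := mem_filter.1 hU
      obtain ⟨-, -, -, hXeq⟩ := hP U hUA
      rw [hX₁, hY₁]; dsimp only
      rw [if_pos hU, smul_mul_smul_comm, Matrix.one_mul, trace_smul, trace_one, Fintype.card_fin, Nat.cast_one, smul_eq_mul, mul_one]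
      conv_rhs => rw [hXeq, hUi, smul_mul_assoc, trace_smul, smul_eq_mul]
      ring
    rw [h3] at h2
    linarith
  linarith

end Summit.PneNP.PneNP.Theorems.ChebyshevTracialDesignDimTwoSynchronisation
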